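import Literature.MathematicalPhysics.KineticTheory.HardSphereHierarchyModel
import Literature.MathematicalPhysics.KineticTheory.HierarchyDuhamelSeriesOn
import Mathlib.MeasureTheory.Group.Prod
import HarnessLib

/-!
# Duhamel terms of the hard-sphere hierarchy respect null sets on domain-supported families,
# given the non-singularity of one transported adjunction
(Bodineau–Gallagher–Saint-Raymond, Invent. Math. 203 (2016) = arXiv:1305.3397v2, §3.1 Remark 3.1
p. 9 and §5.1 p. 15 ("one can check that `Ψ_{i+1}` is well defined up to a set of measure 0
[Simonella 2014]"); Spohn 2006 Thm 11; trunk T-KINETIC, topic MathematicalPhysics/KineticTheory;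
the Duhamel-algebra half of the corrected input (R) of `bgsr_linearBoltzmannApprox_of_domainInputs`
(`TaggedSphereLinearBoltzmannInputs`, `TaggedSphereDomainInputs`).)

The corrected null-set input (R) of the BGSR programme asks: for the hierarchy model of `N` hard
spheres on `T^d` (`hsHierarchyModel`, regularised Alexander flows and outgoing collision
operators), two nice families SUPPORTED IN THE HARD-SPHERE DOMAINS and equal Lebesgue-a.e. at every
level have Lebesgue-a.e. equal Duhamel terms `Q_{s,s+n}(h) G` (`h ≥ 0`). This file PROVES it from
ONE statement about the dynamics, kept as an explicit hypothesis (inline, no named fact): the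
non-singularity of the transported adjunction maps

  `Λ⁺_i : ((u, Z_s), (ω, v)) ↦ Φ^{s+1}_{-u} (outRep_i (gainConfig Z_s i ω v))`,
  `Λ⁻_i : ((u, Z_s), (ω, v)) ↦ Φ^{s+1}_{-u} (outRep_i (lossConfig Z_s i ω v))`

(`Φ` the regularised `(s+1)`-sphere flow), namely that they are quasi-measure-preserving
(pre-images of Lebesgue-null sets are null) from `du dZ_s dσ(ω) dv` restricted to
`{u > 0, ±ω·(v - v_i) > 0, adjoined configuration in D_ε^{s+1}}` to Lebesgue measure on the
`(s+1)`-particle phase space — BGSR's "`Ψ_{i+1}` is well defined up to measure 0" (after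
Simonella 2014), i.e. the collision-cylinder change of variables composed with the
measure-preserving flow; its proof from `HardSphereBoundaryFlux` / `HardSphereOutgoingGood` is a
separate layer.

The argument (an induction which the printed sources leave implicit in "independently of the
chosen versions", Spohn 2006 Thm 11). The order-`n+1` term is
`Q_{s,s+n+1}(h) G (Z) = ∫_0^h K_n^s(τ, Φ^s_{τ-h} Z) dτ` with the *collision source*
`K_n^s(τ, Y) := (C^{out}_{s,s+1} Q_{s+1,s+1+n}(τ) G)(Y)`. We prove by induction on `n` that the
collision sources of the two families agree for `dτ dY`-almost every `(τ, Y)` with `τ > 0`, at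
every level `s` (§3): at `n = 0` the source reads `G_{s+1} ∘ Φ^{s+1}_{-τ}` at the outgoing
adjoined configurations, i.e. `G_{s+1} ∘ Λ^±_i`, and the hypothesis applies; at `n = m + 1` it
reads `∫_0^τ K_m^{s+1}(τ', Φ^{s+1}_{τ'-τ} ∘ outRep ∘ adj) dτ'`, the map
`((τ, Y), q, τ') ↦ (τ', Λ((τ - τ', Y), q))` is quasi-measure-preserving (the hypothesis, a shear
in the two times, Fubini), and the induction hypothesis at level `s + 1` applies. Configurations
adjoined outside the domain contribute nothing for domain-supported data
(`duhamelTerm_hsHierarchyModel_eq_zero_of_not_mem`), vanishing weights nothing either. Finally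
(§4) `(Z, τ) ↦ (τ, Φ^s_{τ-h} Z)` preserves `dZ dτ` (the regularised flow preserves Lebesgue
measure on the whole phase space, §1), so a.e. equality of the sources gives a.e. equality of the
Duhamel terms. No measurability of the Duhamel terms is needed anywhere (null sets have measurable
null supersets: `QuasiMeasurePreserving.ae`, `Measure.ae_ae_of_ae_prod`).

* §1 `Alexander.measurePreserving_regFlow_volume`, `measurePreserving_time_regFlow`,
  `measurePreserving_timeShear` — measure-theoretic preliminaries;
* §2 `outBbgkyOp_congr_of_ae` — the outgoing collision operators of two domain-supported functions
  agreeing at almost every weighted outgoing adjoined configuration of the domain agree;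
* §3 `hs_collisionSource_ae_eq` — the induction;
* §4 `hs_duhamelTerm_ae_eq_of_pullback`, `hs_respectsAEOn_of_pullback(_all)` — **the corrected
  (R) (`HierarchyModel.RespectsAEOn` of `HierarchyDuhamelSeriesOn` for the Lebesgue measures and
  the hard-sphere domains) from the non-singularity hypothesis**, in the exact form of the
  hypothesis `hRob` of `bgsr_linearBoltzmannApprox_of_domainInputs`.

## References

* T. Bodineau, I. Gallagher, L. Saint-Raymond, *The Brownian motion as the limit of a
  deterministic system of hard-spheres*, Invent. Math. 203 (2016) 493–553 = arXiv:1305.3397v2,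
  §3.1 Remark 3.1 p. 9; §5.1 p. 15.
* H. Spohn, *On the integrated form of the BBGKY hierarchy for hard spheres*,
  arXiv:math-ph/0605068, Thm 11 ("independently of the chosen versions").
* S. Simonella, *Evolution of correlation functions in the hard sphere dynamics*, J. Stat. Phys.
  155 (2014) 1191–1221, §3.
-/

open MeasureTheory MeasureTheory.Measure Metric Real Set Filter Function
open scoped InnerProductSpace ENNReal
open Literature.Analysis.FluidPDE (Config configEnergy GCState duhamelTerm duhamelTerm_zero
  duhamelTerm_succ Geometry hardSphereDomain lossConfig gainConfig)

namespace Literature.MathematicalPhysics.KineticTheory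

noncomputable section

-- the instance terms for `σ ⊗ dv` on `S^{d-1} × ℝ^d` exceed the default size bound
set_option synthInstance.maxSize 1024

section Kinetic

variable {d : Type*} [Fintype d]

attribute [local instance] sigmaFinite_volume_phaseSpace

/-! ## §1. Measure-theoretic preliminaries -/

section Prelim

variable {ε : ℝ}

/-- **The regularised Alexander flow preserves Lebesgue measure on the whole phase space**: it
preserves the Liouville measure `vol|_{D_ε}` (`Alexander.measurePreserving_regFlow`) and is the
identity off the hard-sphere domain. [folklore] -/
theorem _root_.Literature.Analysis.FluidPDE.Alexander.measurePreserving_regFlow_volume (hε : 0 < ε) (hε' : ε < 2⁻¹)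
    {N : ℕ} (t : ℝ) :
    MeasurePreserving (Literature.Analysis.FluidPDE.Alexander.regFlow (N := N)
      (Literature.Analysis.FluidPDE.Torus.geometry d) ε t) volume volume := by
  set D := hardSphereDomain (Literature.Analysis.FluidPDE.Torus.geometry d) N ε with hD
  have hDm : MeasurableSet D := measurableSet_hardSphereDomain_torus N ε
  set f := Literature.Analysis.FluidPDE.Alexander.regFlow (N := N) (Literature.Analysis.FluidPDE.Torus.geometry d) ε t
    with hf
  have hfm : Measurable f := Literature.Analysis.FluidPDE.Alexander.measurable_regFlow hε' t
  have hL := Literature.Analysis.FluidPDE.Alexander.measurePreserving_regFlow (d := d) (N := N) hε hε' t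
  rw [Literature.Analysis.FluidPDE.liouville_eq] at hL
  refine ⟨hfm, ?_⟩
  have hsplit : (volume : Measure (Config N d (UnitAddTorus d))) = volume.restrict D + volume.restrict Dᶜ :=
    (Measure.restrict_add_restrict_compl hDm).symm
  have hid : f =ᵐ[volume.restrict Dᶜ] id := by
    rw [EventuallyEq, ae_restrict_iff' hDm.compl]
    refine Eventually.of_forall fun z hz => ?_
    exact Literature.Analysis.FluidPDE.Alexander.regFlow_of_not_mem
      (fun h => hz (Literature.Analysis.FluidPDE.Alexander.good_subset_hardSphereDomain h)) t
  conv_lhs => rw [hsplit]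
  rw [Measure.map_add _ _ hfm, hL.map_eq, Measure.map_congr hid, Measure.map_id, ← hsplit]

/-- The map `(Z, τ) ↦ (τ, Φ_{τ-h} Z)` (regularised flow) sends `dZ dτ` to `dτ dZ`: a skew product
over the identity of the times with measure-preserving fibre maps. [folklore] -/
theorem measurePreserving_time_regFlow (hε : 0 < ε) (hε' : ε < 2⁻¹) {s : ℕ} (h : ℝ) :
    MeasurePreserving
      (fun p : Config s d (UnitAddTorus d) × ℝ =>
        (p.2, Literature.Analysis.FluidPDE.Alexander.regFlow (Literature.Analysis.FluidPDE.Torus.geometry d) ε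
          (p.2 - h) p.1))
      ((volume : Measure (Config s d (UnitAddTorus d))).prod (volume : Measure ℝ))
      ((volume : Measure ℝ).prod (volume : Measure (Config s d (UnitAddTorus d)))) := by
  have hsk : MeasurePreserving
      (fun p : ℝ × Config s d (UnitAddTorus d) =>
        (p.1, Literature.Analysis.FluidPDE.Alexander.regFlow (Literature.Analysis.FluidPDE.Torus.geometry d) ε
          (p.1 - h) p.2))
      ((volume : Measure ℝ).prod (volume : Measure (Config s d (UnitAddTorus d))))
      ((volume : Measure ℝ).prod (volume : Measure (Config s d (UnitAddTorus d)))) := by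
    have hgm : Measurable (uncurry fun (τ : ℝ) (Z : Config s d (UnitAddTorus d)) =>
        Literature.Analysis.FluidPDE.Alexander.regFlow (Literature.Analysis.FluidPDE.Torus.geometry d) ε (τ - h) Z) :=
      (Literature.Analysis.FluidPDE.Alexander.measurable_regFlow_uncurry (d := d) (N := s) hε').comp
        ((measurable_fst.sub measurable_const).prodMk measurable_snd)
    have hg : ∀ᵐ τ : ℝ ∂volume, Measure.map ((fun (τ : ℝ) (Z : Config s d (UnitAddTorus d)) =>
        Literature.Analysis.FluidPDE.Alexander.regFlow (Literature.Analysis.FluidPDE.Torus.geometry d) ε (τ - h) Z) τ)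
          volume = volume :=
      Eventually.of_forall fun τ =>
        (Literature.Analysis.FluidPDE.Alexander.measurePreserving_regFlow_volume (d := d) hε hε' (τ - h)).map_eq
    exact MeasurePreserving.skew_product (μa := (volume : Measure ℝ)) (μb := (volume : Measure ℝ))
      (μc := (volume : Measure (Config s d (UnitAddTorus d)))) (μd := (volume : Measure (Config s d (UnitAddTorus d))))
      (f := id) (MeasurePreserving.id _) hgm hg
  exact hsk.comp (measurePreserving_swap)

omit [Fintype d] in
/-- The time shear `(((τ, Y), q), τ') ↦ (((τ - τ', Y), q), τ')` preserves the product measure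
(translation invariance of `dτ`, as a skew product over the identity of `τ'`). [folklore] -/
theorem measurePreserving_timeShear {α β : Type*} [MeasurableSpace α] [MeasurableSpace β]
    (μ : Measure α) (ν : Measure β) [SFinite μ] [SFinite ν] :
    MeasurePreserving
      (fun z : ((ℝ × α) × β) × ℝ => (((z.1.1.1 - z.2, z.1.1.2), z.1.2), z.2))
      ((((volume : Measure ℝ).prod μ).prod ν).prod (volume : Measure ℝ))
      ((((volume : Measure ℝ).prod μ).prod ν).prod (volume : Measure ℝ)) := by
  -- skew product over `τ'` (put first by a swap)
  have hsk : MeasurePreserving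
      (fun z : ℝ × ((ℝ × α) × β) => (z.1, (((z.2.1.1 - z.1, z.2.1.2), z.2.2) : (ℝ × α) × β)))
      ((volume : Measure ℝ).prod (((volume : Measure ℝ).prod μ).prod ν))
      ((volume : Measure ℝ).prod (((volume : Measure ℝ).prod μ).prod ν)) := by
    have hgm : Measurable (uncurry fun (τ' : ℝ) (w : (ℝ × α) × β) => (((w.1.1 - τ', w.1.2), w.2) : (ℝ × α) × β)) :=
      (((measurable_snd.fst.fst.sub measurable_fst).prodMk measurable_snd.fst.snd).prodMk measurable_snd.snd)
    have hg : ∀ᵐ τ' : ℝ ∂volume, Measure.map ((fun (τ' : ℝ) (w : (ℝ × α) × β) =>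
        (((w.1.1 - τ', w.1.2), w.2) : (ℝ × α) × β)) τ') (((volume : Measure ℝ).prod μ).prod ν) =
          ((volume : Measure ℝ).prod μ).prod ν := by
      refine Eventually.of_forall fun τ' => ?_
      have h1 : MeasurePreserving (fun τ : ℝ => τ - τ') volume volume := measurePreserving_sub_right volume τ'
      exact ((h1.prod (MeasurePreserving.id μ)).prod (MeasurePreserving.id ν)).map_eq
    exact MeasurePreserving.skew_product (μa := (volume : Measure ℝ)) (μb := (volume : Measure ℝ))
      (μc := ((volume : Measure ℝ).prod μ).prod ν) (μd := ((volume : Measure ℝ).prod μ).prod ν)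
      (f := id) (MeasurePreserving.id _) hgm hg
  have h := (measurePreserving_swap.comp hsk).comp
    (measurePreserving_swap (μ := (((volume : Measure ℝ).prod μ).prod ν)) (ν := (volume : Measure ℝ)))
  have h' : (fun z : ((ℝ × α) × β) × ℝ => (((z.1.1.1 - z.2, z.1.1.2), z.1.2), z.2)) =
      (Prod.swap ∘ fun z : ℝ × ((ℝ × α) × β) => (z.1, (((z.2.1.1 - z.1, z.2.1.2), z.2.2) : (ℝ × α) × β))) ∘
        Prod.swap := by
    funext z; rfl
  rw [h']
  exact h

end Prelim

/-! ## §2. Congruence of the outgoing collision operator -/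

section Congr

variable {ε : ℝ} {s : ℕ}

/-- One collision integrand of the outgoing operator: if two functions vanishing off the domain
agree at the outgoing representative of the gain (resp. loss) configuration whenever it is
weighted and in the domain, the integrands agree. [folklore] -/
theorem hsCollisionIntegrand_congr {i : Fin s} {g₁ g₂ : Config (s + 1) d (UnitAddTorus d) → ℝ}
    (hg₁ : ∀ W ∉ hardSphereDomain (Literature.Analysis.FluidPDE.Torus.geometry d) (s + 1) ε, g₁ W = 0)
    (hg₂ : ∀ W ∉ hardSphereDomain (Literature.Analysis.FluidPDE.Torus.geometry d) (s + 1) ε, g₂ W = 0)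
    {Y : Config s d (UnitAddTorus d)} {ω v : EuclideanSpace ℝ d}
    (hgain : 0 < ⟪ω, v - (Y i).2⟫_ℝ →
      gainConfig (Literature.Analysis.FluidPDE.Torus.geometry d) ε Y i ω v ∈
        hardSphereDomain (Literature.Analysis.FluidPDE.Torus.geometry d) (s + 1) ε →
      g₁ (outRep (Literature.Analysis.FluidPDE.Torus.geometry d) s i
          (gainConfig (Literature.Analysis.FluidPDE.Torus.geometry d) ε Y i ω v)) =
        g₂ (outRep (Literature.Analysis.FluidPDE.Torus.geometry d) s i
          (gainConfig (Literature.Analysis.FluidPDE.Torus.geometry d) ε Y i ω v)))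
    (hloss : ⟪ω, v - (Y i).2⟫_ℝ < 0 →
      lossConfig (Literature.Analysis.FluidPDE.Torus.geometry d) ε Y i ω v ∈
        hardSphereDomain (Literature.Analysis.FluidPDE.Torus.geometry d) (s + 1) ε →
      g₁ (outRep (Literature.Analysis.FluidPDE.Torus.geometry d) s i
          (lossConfig (Literature.Analysis.FluidPDE.Torus.geometry d) ε Y i ω v)) =
        g₂ (outRep (Literature.Analysis.FluidPDE.Torus.geometry d) s i
          (lossConfig (Literature.Analysis.FluidPDE.Torus.geometry d) ε Y i ω v))) :
    max ⟪ω, v - (Y i).2⟫_ℝ 0 *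
          g₁ (outRep (Literature.Analysis.FluidPDE.Torus.geometry d) s i
            (gainConfig (Literature.Analysis.FluidPDE.Torus.geometry d) ε Y i ω v)) -
        max (-⟪ω, v - (Y i).2⟫_ℝ) 0 *
          g₁ (outRep (Literature.Analysis.FluidPDE.Torus.geometry d) s i
            (lossConfig (Literature.Analysis.FluidPDE.Torus.geometry d) ε Y i ω v)) =
      max ⟪ω, v - (Y i).2⟫_ℝ 0 *
          g₂ (outRep (Literature.Analysis.FluidPDE.Torus.geometry d) s i
            (gainConfig (Literature.Analysis.FluidPDE.Torus.geometry d) ε Y i ω v)) -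
        max (-⟪ω, v - (Y i).2⟫_ℝ) 0 *
          g₂ (outRep (Literature.Analysis.FluidPDE.Torus.geometry d) s i
            (lossConfig (Literature.Analysis.FluidPDE.Torus.geometry d) ε Y i ω v)) := by
  set b := ⟪ω, v - (Y i).2⟫_ℝ with hb
  have hG : 0 < b →
      g₁ (outRep (Literature.Analysis.FluidPDE.Torus.geometry d) s i
          (gainConfig (Literature.Analysis.FluidPDE.Torus.geometry d) ε Y i ω v)) =
        g₂ (outRep (Literature.Analysis.FluidPDE.Torus.geometry d) s i
          (gainConfig (Literature.Analysis.FluidPDE.Torus.geometry d) ε Y i ω v)) := by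
    intro hb0
    by_cases hD : gainConfig (Literature.Analysis.FluidPDE.Torus.geometry d) ε Y i ω v ∈
        hardSphereDomain (Literature.Analysis.FluidPDE.Torus.geometry d) (s + 1) ε
    · exact hgain hb0 hD
    · rw [hg₁ _ (mt (outRep_mem_hardSphereDomain_iff i _).1 hD),
        hg₂ _ (mt (outRep_mem_hardSphereDomain_iff i _).1 hD)]
  have hL : b < 0 →
      g₁ (outRep (Literature.Analysis.FluidPDE.Torus.geometry d) s i
          (lossConfig (Literature.Analysis.FluidPDE.Torus.geometry d) ε Y i ω v)) =
        g₂ (outRep (Literature.Analysis.FluidPDE.Torus.geometry d) s i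
          (lossConfig (Literature.Analysis.FluidPDE.Torus.geometry d) ε Y i ω v)) := by
    intro hb0
    by_cases hD : lossConfig (Literature.Analysis.FluidPDE.Torus.geometry d) ε Y i ω v ∈
        hardSphereDomain (Literature.Analysis.FluidPDE.Torus.geometry d) (s + 1) ε
    · exact hloss hb0 hD
    · rw [hg₁ _ (mt (outRep_mem_hardSphereDomain_iff i _).1 hD),
        hg₂ _ (mt (outRep_mem_hardSphereDomain_iff i _).1 hD)]
  rcases lt_trichotomy 0 b with hb0 | hb0 | hb0
  · have h1 : max (-b) 0 = 0 := max_eq_right (by linarith)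
    rw [h1, zero_mul, zero_mul, hG hb0]
  · have h1 : max b 0 = 0 := by rw [← hb0, max_self]
    have h2 : max (-b) 0 = 0 := by rw [← hb0, neg_zero, max_self]
    rw [h1, h2, zero_mul, zero_mul, zero_mul, zero_mul]
  · have h1 : max b 0 = 0 := max_eq_right hb0.le
    rw [h1, zero_mul, zero_mul, hL hb0]

/-- **Congruence of the outgoing collision operator**: two functions vanishing off the hard-sphere
domain `D_ε^{s+1}` whose values agree, for every label `i` and `σ ⊗ dv`-almost every `(ω, v)`,
at the outgoing representative of the gain configuration whenever `ω·(v - v_i) > 0` and it lies in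
the domain, and at that of the loss configuration whenever `ω·(v - v_i) < 0` and it lies in the
domain, have the same image under `C^{out}_{s,s+1}` at `Y` (configurations adjoined outside the
domain and unweighted directions contribute nothing). [folklore] -/
theorem outBbgkyOp_congr_of_ae (Ntot : ℕ) {g₁ g₂ : Config (s + 1) d (UnitAddTorus d) → ℝ}
    (hg₁ : ∀ W ∉ hardSphereDomain (Literature.Analysis.FluidPDE.Torus.geometry d) (s + 1) ε, g₁ W = 0)
    (hg₂ : ∀ W ∉ hardSphereDomain (Literature.Analysis.FluidPDE.Torus.geometry d) (s + 1) ε, g₂ W = 0)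
    {Y : Config s d (UnitAddTorus d)}
    (h : ∀ i : Fin s, ∀ᵐ q : sphere (0 : EuclideanSpace ℝ d) 1 × EuclideanSpace ℝ d
        ∂((sphereMeasure (E := EuclideanSpace ℝ d)).prod volume),
      (0 < ⟪(q.1 : EuclideanSpace ℝ d), q.2 - (Y i).2⟫_ℝ →
        gainConfig (Literature.Analysis.FluidPDE.Torus.geometry d) ε Y i q.1 q.2 ∈
          hardSphereDomain (Literature.Analysis.FluidPDE.Torus.geometry d) (s + 1) ε →
        g₁ (outRep (Literature.Analysis.FluidPDE.Torus.geometry d) s i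
            (gainConfig (Literature.Analysis.FluidPDE.Torus.geometry d) ε Y i q.1 q.2)) =
          g₂ (outRep (Literature.Analysis.FluidPDE.Torus.geometry d) s i
            (gainConfig (Literature.Analysis.FluidPDE.Torus.geometry d) ε Y i q.1 q.2))) ∧
      (⟪(q.1 : EuclideanSpace ℝ d), q.2 - (Y i).2⟫_ℝ < 0 →
        lossConfig (Literature.Analysis.FluidPDE.Torus.geometry d) ε Y i q.1 q.2 ∈
          hardSphereDomain (Literature.Analysis.FluidPDE.Torus.geometry d) (s + 1) ε →
        g₁ (outRep (Literature.Analysis.FluidPDE.Torus.geometry d) s i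
            (lossConfig (Literature.Analysis.FluidPDE.Torus.geometry d) ε Y i q.1 q.2)) =
          g₂ (outRep (Literature.Analysis.FluidPDE.Torus.geometry d) s i
            (lossConfig (Literature.Analysis.FluidPDE.Torus.geometry d) ε Y i q.1 q.2)))) :
    outBbgkyOp (Literature.Analysis.FluidPDE.Torus.geometry d) ε Ntot s g₁ Y =
      outBbgkyOp (Literature.Analysis.FluidPDE.Torus.geometry d) ε Ntot s g₂ Y := by
  unfold outBbgkyOp Literature.Analysis.FluidPDE.bbgkyCollisionOp
  refine Finset.sum_congr rfl fun i _ => ?_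
  congr 1
  unfold Literature.Analysis.FluidPDE.hsCollisionTerm
  refine integral_congr_ae ?_
  filter_upwards [Measure.ae_ae_of_ae_prod (h i)] with ω hω
  refine integral_congr_ae ?_
  filter_upwards [hω] with v hv
  simp only [Function.comp_apply]
  exact hsCollisionIntegrand_congr hg₁ hg₂ hv.1 hv.2

end Congr

/-! ## §3. The collision sources of two a.e.-equal domain-supported families agree a.e. -/

section Induction

variable {ε : ℝ} (hε : 0 < ε) (hε' : ε < 2⁻¹) (Ntot : ℕ)

/-- The non-singularity hypothesis for the gain adjunctions: for every level `s` and label `i`,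
`((u, Z_s), (ω, v)) ↦ Φ^{s+1}_{-u}(outRep_i (gainConfig Z_s i ω v))` pulls Lebesgue-null sets of
`(s+1)`-configurations back to null sets of parameters `u > 0`, `ω·(v - v_i) > 0`, adjoined
configuration in `D_ε^{s+1}` (stated as quasi-measure-preservation of the restricted parameter
measure). A predicate on the diameter, used as an explicit HYPOTHESIS of the theorems below (BGSR
p. 15 "`Ψ_{i+1}` is well defined up to a set of measure 0", after Simonella 2014); it is asserted
nowhere in this file. [cite: BodineauGallagherSaintRaymondInvent2016, §5.1, p. 15] -/
def GainPullback (ε : ℝ) : Prop :=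
  ∀ (s : ℕ) (i : Fin s),
    QuasiMeasurePreserving
      (fun p : (ℝ × Config s d (UnitAddTorus d)) × (sphere (0 : EuclideanSpace ℝ d) 1 × EuclideanSpace ℝ d) =>
        Literature.Analysis.FluidPDE.Alexander.regFlow (Literature.Analysis.FluidPDE.Torus.geometry d) ε (-p.1.1)
          (outRep (Literature.Analysis.FluidPDE.Torus.geometry d) s i
            (gainConfig (Literature.Analysis.FluidPDE.Torus.geometry d) ε p.1.2 i p.2.1 p.2.2)))
      ((((volume : Measure ℝ).prod (volume : Measure (Config s d (UnitAddTorus d)))).prod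
          ((sphereMeasure (E := EuclideanSpace ℝ d)).prod (volume : Measure (EuclideanSpace ℝ d)))).restrict
        {p | 0 < p.1.1 ∧ 0 < ⟪(p.2.1 : EuclideanSpace ℝ d), p.2.2 - (p.1.2 i).2⟫_ℝ ∧
          gainConfig (Literature.Analysis.FluidPDE.Torus.geometry d) ε p.1.2 i p.2.1 p.2.2 ∈
            hardSphereDomain (Literature.Analysis.FluidPDE.Torus.geometry d) (s + 1) ε})
      volume

/-- The non-singularity hypothesis for the loss adjunctions (`ω·(v - v_i) < 0`, `lossConfig`); a
predicate on the diameter used as an explicit hypothesis, see `GainPullback`.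
[cite: BodineauGallagherSaintRaymondInvent2016, §5.1, p. 15] -/
def LossPullback (ε : ℝ) : Prop :=
  ∀ (s : ℕ) (i : Fin s),
    QuasiMeasurePreserving
      (fun p : (ℝ × Config s d (UnitAddTorus d)) × (sphere (0 : EuclideanSpace ℝ d) 1 × EuclideanSpace ℝ d) =>
        Literature.Analysis.FluidPDE.Alexander.regFlow (Literature.Analysis.FluidPDE.Torus.geometry d) ε (-p.1.1)
          (outRep (Literature.Analysis.FluidPDE.Torus.geometry d) s i
            (lossConfig (Literature.Analysis.FluidPDE.Torus.geometry d) ε p.1.2 i p.2.1 p.2.2)))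
      ((((volume : Measure ℝ).prod (volume : Measure (Config s d (UnitAddTorus d)))).prod
          ((sphereMeasure (E := EuclideanSpace ℝ d)).prod (volume : Measure (EuclideanSpace ℝ d)))).restrict
        {p | 0 < p.1.1 ∧ ⟪(p.2.1 : EuclideanSpace ℝ d), p.2.2 - (p.1.2 i).2⟫_ℝ < 0 ∧
          lossConfig (Literature.Analysis.FluidPDE.Torus.geometry d) ε p.1.2 i p.2.1 p.2.2 ∈
            hardSphereDomain (Literature.Analysis.FluidPDE.Torus.geometry d) (s + 1) ε})
      volume

/-- The parameter set of the gain adjunctions is measurable. [folklore] -/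
theorem measurableSet_gainParams (s : ℕ) (i : Fin s) :
    MeasurableSet {p : (ℝ × Config s d (UnitAddTorus d)) × (sphere (0 : EuclideanSpace ℝ d) 1 × EuclideanSpace ℝ d) |
      0 < p.1.1 ∧ 0 < ⟪(p.2.1 : EuclideanSpace ℝ d), p.2.2 - (p.1.2 i).2⟫_ℝ ∧
        gainConfig (Literature.Analysis.FluidPDE.Torus.geometry d) ε p.1.2 i p.2.1 p.2.2 ∈
          hardSphereDomain (Literature.Analysis.FluidPDE.Torus.geometry d) (s + 1) ε} := by
  have hin : Measurable fun p : (ℝ × Config s d (UnitAddTorus d)) ×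
      (sphere (0 : EuclideanSpace ℝ d) 1 × EuclideanSpace ℝ d) =>
      ⟪(p.2.1 : EuclideanSpace ℝ d), p.2.2 - (p.1.2 i).2⟫_ℝ :=
    (continuous_subtype_val.measurable.comp measurable_snd.fst).inner
      (measurable_snd.snd.sub ((measurable_pi_apply i).comp measurable_fst.snd).snd)
  have hg : Measurable fun p : (ℝ × Config s d (UnitAddTorus d)) ×
      (sphere (0 : EuclideanSpace ℝ d) 1 × EuclideanSpace ℝ d) =>
      gainConfig (Literature.Analysis.FluidPDE.Torus.geometry d) ε p.1.2 i p.2.1 p.2.2 :=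
    Literature.Analysis.FluidPDE.measurable_gainConfig measurable_translate_torus ε i measurable_fst.snd
      (continuous_subtype_val.measurable.comp measurable_snd.fst) measurable_snd.snd
  exact (measurableSet_lt measurable_const measurable_fst.fst).inter
    ((measurableSet_lt measurable_const hin).inter (hg (measurableSet_hardSphereDomain_torus (s + 1) ε)))

/-- The parameter set of the loss adjunctions is measurable. [folklore] -/
theorem measurableSet_lossParams (s : ℕ) (i : Fin s) :
    MeasurableSet {p : (ℝ × Config s d (UnitAddTorus d)) × (sphere (0 : EuclideanSpace ℝ d) 1 × EuclideanSpace ℝ d) |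
      0 < p.1.1 ∧ ⟪(p.2.1 : EuclideanSpace ℝ d), p.2.2 - (p.1.2 i).2⟫_ℝ < 0 ∧
        lossConfig (Literature.Analysis.FluidPDE.Torus.geometry d) ε p.1.2 i p.2.1 p.2.2 ∈
          hardSphereDomain (Literature.Analysis.FluidPDE.Torus.geometry d) (s + 1) ε} := by
  have hin : Measurable fun p : (ℝ × Config s d (UnitAddTorus d)) ×
      (sphere (0 : EuclideanSpace ℝ d) 1 × EuclideanSpace ℝ d) =>
      ⟪(p.2.1 : EuclideanSpace ℝ d), p.2.2 - (p.1.2 i).2⟫_ℝ :=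
    (continuous_subtype_val.measurable.comp measurable_snd.fst).inner
      (measurable_snd.snd.sub ((measurable_pi_apply i).comp measurable_fst.snd).snd)
  have hl : Measurable fun p : (ℝ × Config s d (UnitAddTorus d)) ×
      (sphere (0 : EuclideanSpace ℝ d) 1 × EuclideanSpace ℝ d) =>
      lossConfig (Literature.Analysis.FluidPDE.Torus.geometry d) ε p.1.2 i p.2.1 p.2.2 :=
    Literature.Analysis.FluidPDE.measurable_lossConfig measurable_translate_torus ε i measurable_fst.snd
      (continuous_subtype_val.measurable.comp measurable_snd.fst) measurable_snd.snd
  exact (measurableSet_lt measurable_const measurable_fst.fst).inter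
    ((measurableSet_lt hin measurable_const).inter (hl (measurableSet_hardSphereDomain_torus (s + 1) ε)))

variable {G₁ G₂ : GCState d (UnitAddTorus d)}

/-- **Base case**: the order-`0` collision sources `C^{out}_{s,s+1}[G_{s+1} ∘ Φ^{s+1}_{-τ}]` of two
domain-supported families agreeing Lebesgue-a.e. agree for `dτ dY`-a.e. `(τ, Y)` with `τ > 0`
(the hypothesis, applied to the null set `{G₁ ≠ G₂}`; `outBbgkyOp_congr_of_ae`). [cite: BodineauGallagherSaintRaymondInvent2016, §3.1 Remark 3.1, p. 9] -/
theorem hs_collisionSource_ae_eq_zero (hCg : GainPullback (d := d) ε) (hCl : LossPullback (d := d) ε)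
    (hv₁ : ∀ k, ∀ Z ∉ hardSphereDomain (Literature.Analysis.FluidPDE.Torus.geometry d) k ε, G₁ k Z = 0)
    (hv₂ : ∀ k, ∀ Z ∉ hardSphereDomain (Literature.Analysis.FluidPDE.Torus.geometry d) k ε, G₂ k Z = 0)
    (hae : ∀ k, G₁ k =ᵐ[volume] G₂ k) (s : ℕ) :
    ∀ᵐ y : ℝ × Config s d (UnitAddTorus d) ∂((volume : Measure ℝ).prod volume), 0 < y.1 →
      (hsHierarchyModel (d := d) hε hε' Ntot).op s
          (duhamelTerm (hsHierarchyModel (d := d) hε hε' Ntot).transport (hsHierarchyModel hε hε' Ntot).op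
            0 (s + 1) y.1 G₁) y.2 =
        (hsHierarchyModel (d := d) hε hε' Ntot).op s
          (duhamelTerm (hsHierarchyModel (d := d) hε hε' Ntot).transport (hsHierarchyModel hε hε' Ntot).op
            0 (s + 1) y.1 G₂) y.2 := by
  -- the hypothesis applied to the null set `{G₁ ≠ G₂}` at level `s + 1`
  have hg : ∀ i : Fin s, ∀ᵐ p : (ℝ × Config s d (UnitAddTorus d)) ×
      (sphere (0 : EuclideanSpace ℝ d) 1 × EuclideanSpace ℝ d)
        ∂(((volume : Measure ℝ).prod (volume : Measure (Config s d (UnitAddTorus d)))).prod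
          ((sphereMeasure (E := EuclideanSpace ℝ d)).prod (volume : Measure (EuclideanSpace ℝ d)))),
      (0 < p.1.1 ∧ 0 < ⟪(p.2.1 : EuclideanSpace ℝ d), p.2.2 - (p.1.2 i).2⟫_ℝ ∧
          gainConfig (Literature.Analysis.FluidPDE.Torus.geometry d) ε p.1.2 i p.2.1 p.2.2 ∈
            hardSphereDomain (Literature.Analysis.FluidPDE.Torus.geometry d) (s + 1) ε) →
        G₁ (s + 1) (Literature.Analysis.FluidPDE.Alexander.regFlow (Literature.Analysis.FluidPDE.Torus.geometry d) ε
            (-p.1.1) (outRep (Literature.Analysis.FluidPDE.Torus.geometry d) s i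
              (gainConfig (Literature.Analysis.FluidPDE.Torus.geometry d) ε p.1.2 i p.2.1 p.2.2))) =
          G₂ (s + 1) (Literature.Analysis.FluidPDE.Alexander.regFlow (Literature.Analysis.FluidPDE.Torus.geometry d) ε
            (-p.1.1) (outRep (Literature.Analysis.FluidPDE.Torus.geometry d) s i
              (gainConfig (Literature.Analysis.FluidPDE.Torus.geometry d) ε p.1.2 i p.2.1 p.2.2))) :=
    fun i => (ae_restrict_iff' (measurableSet_gainParams (ε := ε) s i)).1 ((hCg s i).ae (hae (s + 1)))
  have hl : ∀ i : Fin s, ∀ᵐ p : (ℝ × Config s d (UnitAddTorus d)) ×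
      (sphere (0 : EuclideanSpace ℝ d) 1 × EuclideanSpace ℝ d)
        ∂(((volume : Measure ℝ).prod (volume : Measure (Config s d (UnitAddTorus d)))).prod
          ((sphereMeasure (E := EuclideanSpace ℝ d)).prod (volume : Measure (EuclideanSpace ℝ d)))),
      (0 < p.1.1 ∧ ⟪(p.2.1 : EuclideanSpace ℝ d), p.2.2 - (p.1.2 i).2⟫_ℝ < 0 ∧
          lossConfig (Literature.Analysis.FluidPDE.Torus.geometry d) ε p.1.2 i p.2.1 p.2.2 ∈
            hardSphereDomain (Literature.Analysis.FluidPDE.Torus.geometry d) (s + 1) ε) →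
        G₁ (s + 1) (Literature.Analysis.FluidPDE.Alexander.regFlow (Literature.Analysis.FluidPDE.Torus.geometry d) ε
            (-p.1.1) (outRep (Literature.Analysis.FluidPDE.Torus.geometry d) s i
              (lossConfig (Literature.Analysis.FluidPDE.Torus.geometry d) ε p.1.2 i p.2.1 p.2.2))) =
          G₂ (s + 1) (Literature.Analysis.FluidPDE.Alexander.regFlow (Literature.Analysis.FluidPDE.Torus.geometry d) ε
            (-p.1.1) (outRep (Literature.Analysis.FluidPDE.Torus.geometry d) s i
              (lossConfig (Literature.Analysis.FluidPDE.Torus.geometry d) ε p.1.2 i p.2.1 p.2.2))) :=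
    fun i => (ae_restrict_iff' (measurableSet_lossParams (ε := ε) s i)).1 ((hCl s i).ae (hae (s + 1)))
  haveI : IsFiniteMeasure (sphereMeasure (E := EuclideanSpace ℝ d)) :=
    Literature.Analysis.FluidPDE.isFiniteMeasure_sphereMeasure
  have hall := ae_all_iff.2 fun i => (hg i).and (hl i)
  filter_upwards [Measure.ae_ae_of_ae_prod hall] with y hy hτ
  rw [duhamelTerm_zero, duhamelTerm_zero]
  refine outBbgkyOp_congr_of_ae Ntot (fun W hW => ?_) (fun W hW => ?_) fun i => ?_
  · show G₁ (s + 1) (Literature.Analysis.FluidPDE.Alexander.regFlow (Literature.Analysis.FluidPDE.Torus.geometry d) ε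
      (-y.1) W) = 0
    rw [Literature.Analysis.FluidPDE.Alexander.regFlow_of_not_mem
      (fun h => hW (Literature.Analysis.FluidPDE.Alexander.good_subset_hardSphereDomain h)) (-y.1)]
    exact hv₁ (s + 1) W hW
  · show G₂ (s + 1) (Literature.Analysis.FluidPDE.Alexander.regFlow (Literature.Analysis.FluidPDE.Torus.geometry d) ε
      (-y.1) W) = 0
    rw [Literature.Analysis.FluidPDE.Alexander.regFlow_of_not_mem
      (fun h => hW (Literature.Analysis.FluidPDE.Alexander.good_subset_hardSphereDomain h)) (-y.1)]
    exact hv₂ (s + 1) W hW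
  · filter_upwards [hy] with q hq
    exact ⟨fun hb hD => ((hq i).1 ⟨hτ, hb, hD⟩), fun hb hD => ((hq i).2 ⟨hτ, hb, hD⟩)⟩

/-- **Induction step**: if the order-`m` collision sources of the two families agree a.e. at level
`s + 1`, the order-`m + 1` collision sources agree a.e. at level `s`. The order-`m+1` source at
`(τ, Y)` reads `∫_0^τ K_m^{s+1}(τ', Φ^{s+1}_{τ'-τ}(outRep (adj Y q))) dτ'`; the map
`(((τ, Y), q), τ') ↦ (τ', Λ((τ - τ', Y), q))` is quasi-measure-preserving on the relevant
parameters (the hypothesis, `QuasiMeasurePreserving.prodMap`, the time shear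
`measurePreserving_timeShear`), so the bad set of the induction hypothesis is avoided for a.e.
`(τ, Y)`, a.e. `q`, a.e. `τ'` (`Measure.ae_ae_of_ae_prod`), and `outBbgkyOp_congr_of_ae`
concludes. [cite: BodineauGallagherSaintRaymondInvent2016, §3.1 Remark 3.1, p. 9] -/
theorem hs_collisionSource_ae_eq_succ (hCg : GainPullback (d := d) ε) (hCl : LossPullback (d := d) ε)
    (hv₁ : ∀ k, ∀ Z ∉ hardSphereDomain (Literature.Analysis.FluidPDE.Torus.geometry d) k ε, G₁ k Z = 0)
    (hv₂ : ∀ k, ∀ Z ∉ hardSphereDomain (Literature.Analysis.FluidPDE.Torus.geometry d) k ε, G₂ k Z = 0)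
    (m s : ℕ)
    (ih : ∀ᵐ y : ℝ × Config (s + 1) d (UnitAddTorus d) ∂((volume : Measure ℝ).prod volume), 0 < y.1 →
      (hsHierarchyModel (d := d) hε hε' Ntot).op (s + 1)
          (duhamelTerm (hsHierarchyModel (d := d) hε hε' Ntot).transport (hsHierarchyModel hε hε' Ntot).op
            m (s + 1 + 1) y.1 G₁) y.2 =
        (hsHierarchyModel (d := d) hε hε' Ntot).op (s + 1)
          (duhamelTerm (hsHierarchyModel (d := d) hε hε' Ntot).transport (hsHierarchyModel hε hε' Ntot).op
            m (s + 1 + 1) y.1 G₂) y.2) :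
    ∀ᵐ y : ℝ × Config s d (UnitAddTorus d) ∂((volume : Measure ℝ).prod volume), 0 < y.1 →
      (hsHierarchyModel (d := d) hε hε' Ntot).op s
          (duhamelTerm (hsHierarchyModel (d := d) hε hε' Ntot).transport (hsHierarchyModel hε hε' Ntot).op
            (m + 1) (s + 1) y.1 G₁) y.2 =
        (hsHierarchyModel (d := d) hε hε' Ntot).op s
          (duhamelTerm (hsHierarchyModel (d := d) hε hε' Ntot).transport (hsHierarchyModel hε hε' Ntot).op
            (m + 1) (s + 1) y.1 G₂) y.2 := by
  set M := hsHierarchyModel (d := d) hε hε' Ntot with hM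
  set μP : Measure ((ℝ × Config s d (UnitAddTorus d)) × (sphere (0 : EuclideanSpace ℝ d) 1 × EuclideanSpace ℝ d)) :=
    ((volume : Measure ℝ).prod (volume : Measure (Config s d (UnitAddTorus d)))).prod
      ((sphereMeasure (E := EuclideanSpace ℝ d)).prod (volume : Measure (EuclideanSpace ℝ d))) with hμP
  haveI : IsFiniteMeasure (sphereMeasure (E := EuclideanSpace ℝ d)) :=
    Literature.Analysis.FluidPDE.isFiniteMeasure_sphereMeasure
  haveI : SFinite μP := by rw [hμP]; infer_instance
  -- the collision source of order `m` at level `s + 1`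
  set K : GCState d (UnitAddTorus d) → ℝ × Config (s + 1) d (UnitAddTorus d) → ℝ := fun G y =>
    M.op (s + 1) (duhamelTerm M.transport M.op m (s + 1 + 1) y.1 G) y.2 with hK
  have ih' : ∀ᵐ y : ℝ × Config (s + 1) d (UnitAddTorus d) ∂((volume : Measure ℝ).prod volume),
      0 < y.1 → K G₁ y = K G₂ y := ih
  -- transfer of the induction hypothesis along `Λ` for one adjunction map
  have transfer : ∀ (Λ : (ℝ × Config s d (UnitAddTorus d)) × (sphere (0 : EuclideanSpace ℝ d) 1 × EuclideanSpace ℝ d) →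
        Config (s + 1) d (UnitAddTorus d))
      (S : Set ((ℝ × Config s d (UnitAddTorus d)) × (sphere (0 : EuclideanSpace ℝ d) 1 × EuclideanSpace ℝ d))),
      MeasurableSet S → QuasiMeasurePreserving Λ (μP.restrict S) volume →
      ∀ᵐ y : ℝ × Config s d (UnitAddTorus d) ∂((volume : Measure ℝ).prod volume),
        ∀ᵐ q : sphere (0 : EuclideanSpace ℝ d) 1 × EuclideanSpace ℝ d
          ∂((sphereMeasure (E := EuclideanSpace ℝ d)).prod volume),
        ∀ᵐ τ' : ℝ, ((y.1 - τ', y.2), q) ∈ S → 0 < τ' → K G₁ (τ', Λ ((y.1 - τ', y.2), q)) =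
          K G₂ (τ', Λ ((y.1 - τ', y.2), q)) := by
    intro Λ S hS hΛ
    -- `(p, τ') ↦ (τ', Λ p)` is quasi-measure-preserving on `S × ℝ`
    have h1 : QuasiMeasurePreserving
        (fun z : ((ℝ × Config s d (UnitAddTorus d)) × (sphere (0 : EuclideanSpace ℝ d) 1 × EuclideanSpace ℝ d)) × ℝ =>
          ((z.2, Λ z.1) : ℝ × Config (s + 1) d (UnitAddTorus d)))
        ((μP.restrict S).prod (volume : Measure ℝ)) ((volume : Measure ℝ).prod volume) := by
      have hsw := (measurePreserving_swap (μ := (volume : Measure (Config (s + 1) d (UnitAddTorus d))))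
        (ν := (volume : Measure ℝ))).quasiMeasurePreserving
      have hpm := QuasiMeasurePreserving.prodMap hΛ (QuasiMeasurePreserving.id (volume : Measure ℝ))
      exact hsw.comp hpm
    have h2 := h1.ae ih'
    have hm : (μP.restrict S).prod (volume : Measure ℝ) = (μP.prod volume).restrict (S ×ˢ (univ : Set ℝ)) := by
      rw [← Measure.prod_restrict, Measure.restrict_univ]
    rw [hm] at h2
    have h3 := (ae_restrict_iff' (hS.prod MeasurableSet.univ)).1 h2
    -- the time shear
    have h4 := (measurePreserving_timeShear (volume : Measure (Config s d (UnitAddTorus d)))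
      ((sphereMeasure (E := EuclideanSpace ℝ d)).prod (volume : Measure (EuclideanSpace ℝ d)))).quasiMeasurePreserving.ae h3
    have h5 := Measure.ae_ae_of_ae_prod (Measure.ae_ae_of_ae_prod h4)
    filter_upwards [h5] with y hy
    filter_upwards [hy] with q hq
    filter_upwards [hq] with τ' hτ' hS' h0
    exact hτ' ⟨hS', mem_univ _⟩ h0
  have hG := fun i => transfer _ _ (measurableSet_gainParams (ε := ε) s i) (hCg s i)
  have hL := fun i => transfer _ _ (measurableSet_lossParams (ε := ε) s i) (hCl s i)
  have hall := ae_all_iff.2 fun i => (hG i).and (hL i)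
  filter_upwards [hall] with y hy hτ
  -- the two data at the transported outgoing adjoined configurations
  refine outBbgkyOp_congr_of_ae Ntot
    (fun W hW => duhamelTerm_hsHierarchyModel_eq_zero_of_not_mem hε hε' Ntot hv₁ (m + 1) (s + 1) y.1 W hW)
    (fun W hW => duhamelTerm_hsHierarchyModel_eq_zero_of_not_mem hε hε' Ntot hv₂ (m + 1) (s + 1) y.1 W hW)
    fun i => ?_
  have hne : ∀ᵐ τ' : ℝ, τ' ≠ y.1 :=
    (measure_eq_zero_iff_ae_notMem.1 (measure_singleton y.1)).mono fun x hx => by simpa using hx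
  obtain ⟨hyG, hyL⟩ := hy i
  filter_upwards [hyG, hyL] with q hqG hqL
  constructor
  · intro hb hD
    rw [duhamelTerm_succ, duhamelTerm_succ]
    refine intervalIntegral.integral_congr_ae ?_
    filter_upwards [hqG, hne] with τ' hτ' hτ'ne hI
    rw [uIoc_of_le hτ.le] at hI
    have h0 : 0 < y.1 - τ' := by
      have := hI.2
      exact sub_pos.2 (lt_of_le_of_ne this hτ'ne)
    exact hτ' ⟨h0, hb, hD⟩ hI.1
  · intro hb hD
    rw [duhamelTerm_succ, duhamelTerm_succ]
    refine intervalIntegral.integral_congr_ae ?_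
    filter_upwards [hqL, hne] with τ' hτ' hτ'ne hI
    rw [uIoc_of_le hτ.le] at hI
    have h0 : 0 < y.1 - τ' := by
      have := hI.2
      exact sub_pos.2 (lt_of_le_of_ne this hτ'ne)
    exact hτ' ⟨h0, hb, hD⟩ hI.1

/-- **The collision sources of two a.e.-equal domain-supported nice families agree almost
everywhere**, at every order `n` and level `s`: for `dτ dY`-a.e. `(τ, Y)` with `τ > 0`,
`C^{out}_{s,s+1} Q_{s+1,s+1+n}(τ) G₁ (Y) = C^{out}_{s,s+1} Q_{s+1,s+1+n}(τ) G₂ (Y)` (induction on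
`n`: `hs_collisionSource_ae_eq_zero`, `hs_collisionSource_ae_eq_succ`).
[cite: BodineauGallagherSaintRaymondInvent2016, §3.1 Remark 3.1, p. 9] -/
theorem hs_collisionSource_ae_eq (hCg : GainPullback (d := d) ε) (hCl : LossPullback (d := d) ε)
    (hv₁ : ∀ k, ∀ Z ∉ hardSphereDomain (Literature.Analysis.FluidPDE.Torus.geometry d) k ε, G₁ k Z = 0)
    (hv₂ : ∀ k, ∀ Z ∉ hardSphereDomain (Literature.Analysis.FluidPDE.Torus.geometry d) k ε, G₂ k Z = 0)
    (hae : ∀ k, G₁ k =ᵐ[volume] G₂ k) (n : ℕ) :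
    ∀ s : ℕ, ∀ᵐ y : ℝ × Config s d (UnitAddTorus d) ∂((volume : Measure ℝ).prod volume), 0 < y.1 →
      (hsHierarchyModel (d := d) hε hε' Ntot).op s
          (duhamelTerm (hsHierarchyModel (d := d) hε hε' Ntot).transport (hsHierarchyModel hε hε' Ntot).op
            n (s + 1) y.1 G₁) y.2 =
        (hsHierarchyModel (d := d) hε hε' Ntot).op s
          (duhamelTerm (hsHierarchyModel (d := d) hε hε' Ntot).transport (hsHierarchyModel hε hε' Ntot).op
            n (s + 1) y.1 G₂) y.2 := by
  induction n with
  | zero => intro s; exact hs_collisionSource_ae_eq_zero hε hε' Ntot hCg hCl hv₁ hv₂ hae s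
  | succ m ih => intro s; exact hs_collisionSource_ae_eq_succ hε hε' Ntot hCg hCl hv₁ hv₂ m s (ih (s + 1))

/-! ## §4. The corrected null-set input (R) from the non-singularity hypothesis -/

/-- **Duhamel terms of the hard-sphere hierarchy respect Lebesgue-null sets on domain-supported
families** (the corrected input (R) of `bgsr_linearBoltzmannApprox_of_domainInputs`), GIVEN the
non-singularity of the transported adjunctions (`GainPullback`, `LossPullback`): for nice
families `G₁, G₂` vanishing off the hard-sphere domains and equal Lebesgue-a.e. at every level,
`Q_{s,s+n}(h) G₁ = Q_{s,s+n}(h) G₂` Lebesgue-a.e., for every `n`, `s` and `h ≥ 0`. Order `0`: the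
regularised flow preserves Lebesgue measure; order `n + 1`:
`Q_{s,s+n+1}(h) G (Z) = ∫_0^h K_n^s(τ, Φ^s_{τ-h} Z) dτ`, the sources agree a.e.
(`hs_collisionSource_ae_eq`) and `(Z, τ) ↦ (τ, Φ^s_{τ-h} Z)` preserves the product measure
(`measurePreserving_time_regFlow`). [cite: BodineauGallagherSaintRaymondInvent2016, §3.1 Remark 3.1, p. 9] -/
theorem hs_duhamelTerm_ae_eq_of_pullback (hCg : GainPullback (d := d) ε) (hCl : LossPullback (d := d) ε)
    (n s : ℕ) {h : ℝ} (hh : 0 ≤ h)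
    (h₁ : ∀ k, IsNice (G₁ k)) (h₂ : ∀ k, IsNice (G₂ k))
    (hv₁ : ∀ k, ∀ Z ∉ hardSphereDomain (Literature.Analysis.FluidPDE.Torus.geometry d) k ε, G₁ k Z = 0)
    (hv₂ : ∀ k, ∀ Z ∉ hardSphereDomain (Literature.Analysis.FluidPDE.Torus.geometry d) k ε, G₂ k Z = 0)
    (hae : ∀ k, G₁ k =ᵐ[volume] G₂ k) :
    duhamelTerm (hsHierarchyModel (d := d) hε hε' Ntot).transport (hsHierarchyModel hε hε' Ntot).op n s h G₁
      =ᵐ[volume]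
    duhamelTerm (hsHierarchyModel (d := d) hε hε' Ntot).transport (hsHierarchyModel hε hε' Ntot).op n s h G₂ := by
  have _ := h₁; have _ := h₂
  cases n with
  | zero =>
    have h0 := (Literature.Analysis.FluidPDE.Alexander.measurePreserving_regFlow_volume (d := d) (N := s) hε hε'
      (-h)).quasiMeasurePreserving.ae (hae s)
    filter_upwards [h0] with Z hZ
    rw [duhamelTerm_zero, duhamelTerm_zero]
    exact hZ
  | succ m =>
    have hsrc := hs_collisionSource_ae_eq hε hε' Ntot hCg hCl hv₁ hv₂ hae m s
    have h1 := (measurePreserving_time_regFlow (d := d) hε hε' (s := s) h).quasiMeasurePreserving.ae hsrc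
    filter_upwards [Measure.ae_ae_of_ae_prod h1] with Z hZ
    rw [duhamelTerm_succ, duhamelTerm_succ]
    refine intervalIntegral.integral_congr_ae ?_
    filter_upwards [hZ] with τ hτ hI
    rw [uIoc_of_le hh] at hI
    simp only [HierarchyModel.transport_apply, hsHierarchyModel_flow]
    rw [show -(h - τ) = τ - h from neg_sub h τ]
    exact hτ hI.1

/-- **The hard-sphere hierarchy respects Lebesgue-null sets on domain-supported families**
(`HierarchyModel.RespectsAEOn` of `HierarchyDuhamelSeriesOn`, the corrected input (R)), given the
non-singularity of the transported adjunctions. [cite: BodineauGallagherSaintRaymondInvent2016, §3.1 Remark 3.1, p. 9] -/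
theorem hs_respectsAEOn_of_pullback (hCg : GainPullback (d := d) ε) (hCl : LossPullback (d := d) ε) :
    (hsHierarchyModel (d := d) hε hε' Ntot).RespectsAEOn (fun _ => volume)
      (fun k => hardSphereDomain (Literature.Analysis.FluidPDE.Torus.geometry d) k ε) :=
  fun n s _ hh _ _ h₁ h₂ hv₁ hv₂ hae =>
    hs_duhamelTerm_ae_eq_of_pullback hε hε' Ntot hCg hCl n s hh h₁ h₂ hv₁ hv₂ hae

/-- **The corrected input (R) of `bgsr_linearBoltzmannApprox_of_domainInputs`, from the
non-singularity of the transported adjunctions at every physical diameter** (binder for binder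
the hypothesis `hRob` there). [cite: BodineauGallagherSaintRaymondInvent2016, §3.1 Remark 3.1, p. 9] -/
theorem hs_respectsAEOn_of_pullback_all
    (hC : ∀ (ε : ℝ), 0 < ε → ε < 2⁻¹ → GainPullback (d := d) ε ∧ LossPullback (d := d) ε) :
    ∀ (Ntot : ℕ) (ε : ℝ) (hε : 0 < ε) (hε' : ε < 2⁻¹),
      (hsHierarchyModel (d := d) hε hε' Ntot).RespectsAEOn (fun _ => volume)
        (fun k => hardSphereDomain (Literature.Analysis.FluidPDE.Torus.geometry d) k ε) :=
  fun Ntot ε hε hε' => hs_respectsAEOn_of_pullback hε hε' Ntot (hC ε hε hε').1 (hC ε hε hε').2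

end Induction

end Kinetic

end

end Literature.MathematicalPhysics.KineticTheory
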